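import Summits.BirchSwinnertonDyer.BirchSwinnertonDyer.Theorems.QuadraticBranchSignedControlPlusEtaNonsurjThetaFunctionalEquationOrder
import Literature.Barriers.BirchSwinnertonDyer.PAdicFunctionalEquationParityProofs
import HarnessLib

/-!
# Route `QuadraticBranchSignedControl` (rung K8, cell `bsd-potss`), residual crux `PlusEtaMainConjectureNonsurj`
# (stmt-BirchSwinnertonDyer-19606): THE FUNCTIONAL EQUATION ON THE QUADRATIC BRANCH, VII — ROOT-NUMBER CURRENCY at the conductor
# level: `(−1)^{λ(L_p^±(V,η,X))} = (−1)^{ord_T} = w_V · (−N_V | p)`, and `w_V·(−N_V|p) = −1 ⇒ L_p⁺(V,η,0) = 0`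
# (seat `bsd-potss-k8eta-c2` g27; kernel, class-wide; sequel of `…ThetaFunctionalEquationOrder`)

WHY. Parts V–VI (p761517, p761839) state the parity law with the Fricke sign `σ` of the newform (`w_N f = −σ f`) at an arbitrary level.
For the newform of the row `V` AT ITS CONDUCTOR LEVEL `N_V` the tree identifies `σ` with the global root number:
`w_V = V.rootNumber = −ε(f)` (`rootNumber_eq_neg_frickeEigenvalue`, with Hecke's functional equation
`IsNewform0.exists_functional_equation_holds` and Atkin–Lehner `IsNewform0.frickeEigenvalue_eq_one_or_eq_neg_one_holds` both PROVED in
the tree). THIS FILE rewrites the laws in that currency — the quantities of the census (PARI `ellrootno(V)`, the conductor `N_V`):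
`(−1)^{λ(L)} = (−1)^{ord_T L} = w_V·(−N_V | p)` for every nonzero `L_p^±(V, η, X)`, and `w_V·(−N_V|p) = −1 ⇒ L_p⁺(V, η, 0) = 0`. By the
classical twist formula `w(V ⊗ η) = w_V·η(−N_V)` (not in the tree for additive twists) the right-hand side is `w(W)`, the root number of
the additive partner `W = V^{(p*)}` — census P-27S/S2: `ε(W) = w_V·(−N_V|p)` on 205/205 rows.

WHAT. §17 `atkinLehnerInvolution_eq_neg_rootNumber_smul` (`w_{N_V} f = −w_V f`), `rootNumber_sq_eq_one`,
**`neg_one_pow_lam_{plus,minus}_eq_rootNumber_mul_legendreSym`**, `neg_one_pow_order_plus_eq_rootNumber_mul_legendreSym`,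
**`constantCoeff_plus_eq_zero_of_rootNumber_mul_legendreSym_eq_neg_one`**.

HONEST FRAMING (cell `bsd-potss`; FULL-BSD rank ≤ 1 programme, HUMAN RULING D-0036/D-0074): TOOL THEOREMS ONLY — no definition, no
named fact minted (Mazur's `mazur_not_dvd_maninConstant_of_odd` in hypothesis position, as in the lineage's records), no `sorry`, axioms
standard; nothing about (A), (C1⁺_η), C-cc-1 or `BSD(W,p)` of any pair is claimed; no stub of 19606 is proved; crux and route OPEN;
nothing booked. `--supports stmt-BirchSwinnertonDyer-19606`.

References: [AtkinLehner1970] Thm. 3; [Darmon2004] (2.13)–(2.17); [MazurTateTeitelbaum1986Invent] §I.17; [Kobayashi2003] Thm. 3.2,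
(3.4)–(3.6); [Mazur1978] Cor. 4.1. Tree: Parts V–VI, `HeegnerPointReflectionProofs.lean` (`rootNumber_eq_neg_frickeEigenvalue`),
`Barriers/BirchSwinnertonDyer/PAdicFunctionalEquationParityProofs.lean` (the trivial-branch precedent `padicLFunction_functional_equation_conductorLevel`).
-/

set_option autoImplicit false
set_option linter.dupNamespace false
noncomputable section

open scoped Classical MatrixGroups ModularForm

open CongruenceSubgroup Polynomial WeierstrassCurve Literature.NumberTheory.EllipticCurves
  Literature.NumberTheory.EllipticCurves.ModularForms
open Summit.BirchSwinnertonDyer.Rank1Residual.Additive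
open Summit.BirchSwinnertonDyer.Rank1Residual.X1.MuLambda (lam)

namespace Summit.BirchSwinnertonDyer.BirchSwinnertonDyer.Theorems.EtaThetaFunctionalEquation

variable {p : ℕ} [hp : Fact p.Prime]

/-! ## §17 Root-number currency at the conductor level: `σ = w_V` -/

section Root

variable {V : WeierstrassCurve ℚ} [V.IsElliptic] [NeZero (V.conductorNorm ℤ)]
  {f : CuspForm (Gamma0 (V.conductorNorm ℤ)) 2}

omit hp in
/-- **At the conductor level the Fricke sign is the root number**: for the newform `f ∈ S₂(Γ₀(N_V))` of `V`,
`w_{N_V} f = −w_V f` (`w_V = V.rootNumber = −ε(f)`, the tree's `rootNumber_eq_neg_frickeEigenvalue` with Hecke's functional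
equation and Atkin–Lehner discharged). [cite: AtkinLehner1970, Thm. 3] -/
theorem atkinLehnerInvolution_eq_neg_rootNumber_smul (hf : IsNewformOf V f) :
    atkinLehnerInvolution (V.conductorNorm ℤ) 2 (V.conductorNorm ℤ) f = (-((V.rootNumber : ℤ) : ℂ)) • f := by
  have hw : (V.rootNumber : ℂ) = -frickeEigenvalue f :=
    rootNumber_eq_neg_frickeEigenvalue (fun _ _ ↦ IsNewform0.exists_functional_equation_holds)
      (fun _ _ ↦ IsNewform0.frickeEigenvalue_eq_one_or_eq_neg_one_holds) hf
  rw [atkinLehnerInvolution_self_eq_frickeInvolution,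
    IsNewform0.frickeInvolution_eq_smul_holds (N := V.conductorNorm ℤ) (k := (2 : ℤ)) hf.1, hw, neg_neg]

omit hp [V.IsElliptic] [NeZero (V.conductorNorm ℤ)] in
/-- `w_V² = 1`. [folklore] -/
theorem rootNumber_sq_eq_one : V.rootNumber ^ 2 = 1 := by
  rcases V.rootNumber_eq_one_or with h | h <;> rw [h] <;> norm_num

variable [V.IsGloballyMinimal]

/-- **`(−1)^{λ(L_p⁺(V,η,X))} = w_V · (−N_V | p)`**: for `V` globally minimal, good at `p ≥ 5` with `a_p(V) = 0`, `f` its newform AT LEVEL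
`N_V`, Mazur's `hM`, any period ratio `ϖ` and any nonzero plus branch function. The right-hand side is `w_V η(−N_V) = w(V ⊗ η)`, the root
number of the additive partner `W = V^{(p*)}`. [cite: MazurTateTeitelbaum1986Invent, §I.17] [cite: Kobayashi2003, Thm. 3.2, (3.4)]
[cite: AtkinLehner1970, Thm. 3] [cite: Mazur1978, Cor. 4.1] -/
theorem neg_one_pow_lam_plus_eq_rootNumber_mul_legendreSym (hM : mazur_not_dvd_maninConstant_of_odd) (hp5 : 5 ≤ p)
    (hgood : V.HasGoodReductionAtPrime p) (hap : V.frobeniusTrace p = 0) (hf : IsNewformOf V f) (ϖ : ℚ)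
    (hrel : if Even (p / 2) then (ϖ : ℝ) * V.realPeriodRat = plusPeriod f
      else (ϖ : ℝ) * V.imaginaryPeriodRat = minusPeriod f)
    {Lη : IwasawaAlgebra p} (hL : IsQuadraticBranchPlusLFunction f p ϖ Lη) (hL0 : Lη ≠ 0) :
    (-1 : ℤ) ^ lam Lη = V.rootNumber * legendreSym p (-(V.conductorNorm ℤ : ℤ)) :=
  neg_one_pow_lam_plus_row hM hp5 V hgood hap hf rootNumber_sq_eq_one (atkinLehnerInvolution_eq_neg_rootNumber_smul hf)
    ϖ hrel hL hL0

/-- **`(−1)^{λ(L_p⁻(V,η,X))} = w_V · (−N_V | p)`** (minus twin). [cite: MazurTateTeitelbaum1986Invent, §I.17]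
[cite: Kobayashi2003, Thm. 3.2, (3.5)] [cite: AtkinLehner1970, Thm. 3] [cite: Mazur1978, Cor. 4.1] -/
theorem neg_one_pow_lam_minus_eq_rootNumber_mul_legendreSym (hM : mazur_not_dvd_maninConstant_of_odd) (hp5 : 5 ≤ p)
    (hgood : V.HasGoodReductionAtPrime p) (hap : V.frobeniusTrace p = 0) (hf : IsNewformOf V f) (ϖ : ℚ)
    (hrel : if Even (p / 2) then (ϖ : ℝ) * V.realPeriodRat = plusPeriod f
      else (ϖ : ℝ) * V.imaginaryPeriodRat = minusPeriod f)
    {Lη : IwasawaAlgebra p} (hL : IsQuadraticBranchMinusLFunction f p ϖ Lη) (hL0 : Lη ≠ 0) :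
    (-1 : ℤ) ^ lam Lη = V.rootNumber * legendreSym p (-(V.conductorNorm ℤ : ℤ)) :=
  neg_one_pow_lam_minus_row hM hp5 V hgood hap hf rootNumber_sq_eq_one (atkinLehnerInvolution_eq_neg_rootNumber_smul hf)
    ϖ hrel hL hL0

/-- **`(−1)^{ord_{T=0} L_p⁺(V,η,X)} = w_V · (−N_V | p)`** (order of vanishing at `T = 0`, conductor-level newform).
[cite: MazurTateTeitelbaum1986Invent, §I.17] [cite: GreenbergLNM1716, §5] [cite: Mazur1978, Cor. 4.1] -/
theorem neg_one_pow_order_plus_eq_rootNumber_mul_legendreSym (hM : mazur_not_dvd_maninConstant_of_odd) (hp5 : 5 ≤ p)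
    (hgood : V.HasGoodReductionAtPrime p) (hap : V.frobeniusTrace p = 0) (hf : IsNewformOf V f) (ϖ : ℚ)
    (hrel : if Even (p / 2) then (ϖ : ℝ) * V.realPeriodRat = plusPeriod f
      else (ϖ : ℝ) * V.imaginaryPeriodRat = minusPeriod f)
    {Lη : IwasawaAlgebra p} (hL : IsQuadraticBranchPlusLFunction f p ϖ Lη) (hL0 : Lη ≠ 0) :
    (-1 : ℤ) ^ Lη.order.toNat = V.rootNumber * legendreSym p (-(V.conductorNorm ℤ : ℤ)) := by
  have hp2 : p ≠ 2 := by omega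
  have hap' : cuspCoeff f p = ((0 : ℤ) : ℂ) := by
    rw [cuspCoeff_eq_frobeniusTrace_of_isNewformOf_holds hf hgood, hap]
  exact neg_one_pow_order_eq_sign_of_isQuadraticBranchPlusLFunction hp2 hf.1 hf.coeffField_eq_bot
    (not_dvd_level_of_isNewformOf hf hgood) hap' rootNumber_sq_eq_one (atkinLehnerInvolution_eq_neg_rootNumber_smul hf)
    (EtaMinusCoeffCongruence.norm_periodRatio_le_one_of_mazur p hM hp5 V f hf hgood hap ϖ hrel) hL hL0

/-- **`w_V·(−N_V | p) = −1` forces `L_p⁺(V, η, 0) = 0`** (conductor-level newform; every plus branch function):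
the `p`-adic functional equation sees the central zero of `L(V ⊗ η, s)` forced by the sign `w(V ⊗ η) = −1`.
[cite: Kobayashi2003, (3.6) (p. 7)] [cite: MazurTateTeitelbaum1986Invent, §I.17] [cite: Mazur1978, Cor. 4.1] -/
theorem constantCoeff_plus_eq_zero_of_rootNumber_mul_legendreSym_eq_neg_one (hM : mazur_not_dvd_maninConstant_of_odd)
    (hp5 : 5 ≤ p) (hgood : V.HasGoodReductionAtPrime p) (hap : V.frobeniusTrace p = 0) (hf : IsNewformOf V f)
    (hsign : V.rootNumber * legendreSym p (-(V.conductorNorm ℤ : ℤ)) = -1) (ϖ : ℚ)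
    (hrel : if Even (p / 2) then (ϖ : ℝ) * V.realPeriodRat = plusPeriod f
      else (ϖ : ℝ) * V.imaginaryPeriodRat = minusPeriod f)
    {Lη : IwasawaAlgebra p} (hL : IsQuadraticBranchPlusLFunction f p ϖ Lη) :
    PowerSeries.constantCoeff Lη = 0 := by
  have hp2 : p ≠ 2 := by omega
  have hap' : cuspCoeff f p = ((0 : ℤ) : ℂ) := by
    rw [cuspCoeff_eq_frobeniusTrace_of_isNewformOf_holds hf hgood, hap]
  exact constantCoeff_eq_zero_of_sign_eq_neg_one_of_isQuadraticBranchPlusLFunction hp2 hf.1 hf.coeffField_eq_bot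
    (not_dvd_level_of_isNewformOf hf hgood) hap' rootNumber_sq_eq_one (atkinLehnerInvolution_eq_neg_rootNumber_smul hf) hsign
    (EtaMinusCoeffCongruence.norm_periodRatio_le_one_of_mazur p hM hp5 V f hf hgood hap ϖ hrel) hL

end Root

end Summit.BirchSwinnertonDyer.BirchSwinnertonDyer.Theorems.EtaThetaFunctionalEquation

end
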